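/-
Copyright (c) 2026. All rights reserved.
Released under Apache 2.0 license as described in the file LICENSE.
Authors: abc-iut cell, seat abc-iut-L4-t15 (gen 6).
-/
import Literature.GroupTheory.PByMetacyclicQMNDescent

/-!
# Bounded commutator width in `p`-group-by-metacyclic finite groups (without Nikolov–Segal)

**Setting.** `G` is a finite group, `P ⊴ G` a normal `p`-subgroup, `t, s ∈ G` with
`(T1)` every conjugate of `t` in `⟨t⟩P` (`∀ w, ∃ a, ∃ y ∈ P, w t w⁻¹ = t ^ a * y`),
`(T2)` `t ^ e ∈ P` for some `e` coprime to `p`,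
`(T3)` every conjugate of `s` in `⟨t⟩ s P`, and a slot tuple `g : Fin d → G` with
`(G1)` `G = ⟨g_0, …, g_{d-1}⟩`, `(G2)` each `g_j ∈ P` or `g_j = t` or `g_j = s`, `(G3)` `t = g_{jt}`,
`s = g_{js}`, `(G4)` `P` is the normal closure of the `g_j` lying in `P`.
This is the shape of every finite quotient of the absolute Galois group `G_k` of a `p`-adic field `k`
(`P` = wild inertia, `t` = tame generator, `s` = Frobenius, `g` = (generators of `P` as a normal
subgroup, `t`, `s`)), and more generally of a profinite group with a normal pro-`p` subgroup that is
finitely generated as a normal subgroup and whose quotient is (procyclic pro-`p'`, normal)-by-procyclic.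

**Main theorem** (`commutator_eq_prod_commutator_slots`): for every normal subgroup `H ≤ P`,

  `⁅H, G⁆ = ⁅H, g_0⁆ · ⁅H, g_1⁆ ⋯ ⁅H, g_{d-1}⁆`   (product of the SETS `⁅H, g⁆ = {⁅y, g⁆ | y ∈ H}`),

i.e. every element of `⁅H, G⁆` is an ordered product `∏_j ⁅y_j, g_j⁆` with `y_j ∈ H` — commutator width
`d`, independent of `|G|`; and (`mem_commutator_sup_pow_iff`) every element of `⁅H,G⁆ · H^{n}` is
`y^n ∏_j ⁅y_j, g_j⁆`.  For topologically finitely generated PROFINITE groups of this shape this yields the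
closedness of the abstract subgroups `⁅P', U⁆ P'^{n}` (the residual `(d')` of
`Literature/GroupTheory/StronglyCompleteWildReduction.lean`) WITHOUT the theorem of Nikolov–Segal.

**Proof** (an exact, non-probabilistic specialisation of the Nikolov–Segal strategy, Ann. of Math. 165
(2007), §§2–4, made elementary by the structure of the chief factors): the top stage is N–S Lemma 2.4
(`CommutatorHypocentral`); below the `G`-hypocentral residual `K₀ = ⁅K₀, G⁆` one lifts exactly through
successive quasi-minimal normal subgroups (`PByMetacyclicQMNDescent.lift_through_qmn`), by induction on
`|K|` passing to `G ⧸ N` (the setting descends to quotients).  Validated numerically (GAP, cell abc-iut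
jobs j254032/j254094: 7 groups up to class 4, three slot orders, 0 misses).

Finite group theory over Mathlib; no definitions, no instances; no use of the classification of finite
simple groups (cell abc-iut, GAP-LEDGER G-L3d2g2-1; F-1977 / F-0412 neighbourhood).
-/

namespace Literature.GroupTheory

open scoped commutatorElement

universe u

/-! ### Ordered commutator products under homomorphisms -/

/-- A homomorphism maps `Φ_{c•g}(x) = ∏_j ⁅x j, c j * g j * (c j)⁻¹⁆` to the corresponding product of the
images. [folklore] -/
private theorem map_prod_commutator_conj {G K : Type*} [Group G] [Group K] (f : G →* K) {d : ℕ}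
    (g c x : Fin d → G) :
    f (List.ofFn fun j => ⁅x j, c j * g j * (c j)⁻¹⁆).prod =
      (List.ofFn fun j => ⁅f (x j), f (c j) * f (g j) * (f (c j))⁻¹⁆).prod := by
  rw [map_list_prod, List.map_ofFn]
  exact congrArg (fun φ : Fin d → K => (List.ofFn φ).prod)
    (funext fun j => by simp [map_commutatorElement, map_mul, map_inv])

/-! ### Exact lifting modulo an acceptable subgroup -/

/-- **Exact lifting modulo a `G`-perfect normal subgroup `K ≤ P`.**  In the setting of the module
docstring, let `K ⊴ G`, `K ≤ P`, `⁅K, G⁆ = K`.  Then for every normal `Hn ⊇ K`, every conjugating tuple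
`c`, every `κ` and entries `x j ∈ Hn` with `κ⁻¹ Φ_{c•g}(x) ∈ K` there are entries `x' j ∈ Hn` with
`κ⁻¹ Φ_{c•g}(x') = 1` (induction on `|K|` through a quasi-minimal normal `N ≤ K`, passing to `G ⧸ N`).
[cite: NikolovSegal2007, Proposition 4.4] -/
theorem lift_of_commutator_eq_self :
    ∀ (n : ℕ) {G : Type u} [Group G] [Finite G] {p : ℕ} [Fact p.Prime] (P : Subgroup G)
    [P.Normal], IsPGroup p P → ∀ (t s : G) (e : ℕ), t ^ e ∈ P → p.Coprime e →
    (∀ w : G, ∃ a : ℕ, ∃ y ∈ P, w * t * w⁻¹ = t ^ a * y) →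
    (∀ w : G, ∃ a : ℕ, ∃ y ∈ P, w * s * w⁻¹ = t ^ a * s * y) →
    ∀ {d : ℕ} (g : Fin d → G), Subgroup.closure (Set.range g) = ⊤ →
    (∀ j, g j ∈ P ∨ g j = t ∨ g j = s) → ∀ (jt js : Fin d), g jt = t → g js = s →
    P ≤ Subgroup.normalClosure {x | x ∈ Set.range g ∧ x ∈ P} →
    ∀ (K : Subgroup G) [K.Normal], K ≤ P → ⁅K, (⊤ : Subgroup G)⁆ = K → Nat.card K ≤ n →
    ∀ (Hn : Subgroup G) [Hn.Normal], K ≤ Hn →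
    ∀ (c : Fin d → G) (κ : G) (x : Fin d → G), (∀ j, x j ∈ Hn) →
      κ⁻¹ * (List.ofFn fun j => ⁅x j, c j * g j * (c j)⁻¹⁆).prod ∈ K →
      ∃ x' : Fin d → G, (∀ j, x' j ∈ Hn) ∧
        κ⁻¹ * (List.ofFn fun j => ⁅x' j, c j * g j * (c j)⁻¹⁆).prod = 1 := by
  intro n
  induction n with
  | zero =>
    intro G _ _ p _ P _ hPp t s e hte hpe ht_conj hs_conj d g hgen hslots jt js hjt hjs hPgen K _
      hKP hKG hcard
    exact absurd hcard (not_le.mpr (Nat.card_pos (α := K)))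
  | succ n ih =>
    intro G _ _ p _ P hPn hPp t s e hte hpe ht_conj hs_conj d g hgen hslots jt js hjt hjs hPgen K hKn
      hKP hKG hcard Hn hHn hKHn c κ x hx hκ
    classical
    by_cases hK1 : K = ⊥
    · -- nothing to lift
      subst hK1
      exact ⟨x, hx, Subgroup.mem_bot.mp hκ⟩
    -- a quasi-minimal normal subgroup `N ≤ K`
    obtain ⟨N, hNK, hNn, hNG, hN1, hmin⟩ := exists_qmn_le K hKG hK1
    haveI := hNn
    have hNP : N ≤ P := hNK.trans hKP
    have hNHn : N ≤ Hn := hNK.trans hKHn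
    -- pass to `G ⧸ N`
    let mk := QuotientGroup.mk' N
    have hsurj : Function.Surjective mk := QuotientGroup.mk'_surjective N
    haveI hPbar : (P.map mk).Normal := hPn.map mk hsurj
    haveI hKbar : (K.map mk).Normal := hKn.map mk hsurj
    haveI hHnbar : (Hn.map mk).Normal := hHn.map mk hsurj
    -- cardinality drops
    have hcardK : Nat.card (K.map mk) < Nat.card K := by
      have h1 : Nat.card (K.map mk) = (N.subgroupOf K).index := by
        rw [← MonoidHom.restrict_range, ← Subgroup.index_ker, MonoidHom.ker_restrict,
          QuotientGroup.ker_mk']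
      have h2 : Nat.card (N.subgroupOf K) * (N.subgroupOf K).index = Nat.card K :=
        (N.subgroupOf K).card_mul_index
      have h3 : Nat.card (N.subgroupOf K) = Nat.card N :=
        Nat.card_congr (Subgroup.subgroupOfEquivOfLe hNK).toEquiv
      have h4 : 1 < Nat.card N := (Subgroup.one_lt_card_iff_ne_bot N).mpr hN1
      have h5 : 0 < (N.subgroupOf K).index := Nat.pos_of_ne_zero Subgroup.FiniteIndex.index_ne_zero
      rw [h1]; rw [h3] at h2; nlinarith
    have hcardK' : Nat.card (K.map mk) ≤ n := Nat.lt_succ_iff.mp (hcardK.trans_le hcard)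
    -- the setting in `G ⧸ N`
    have hPp' : IsPGroup p (P.map mk) := hPp.map mk
    have hte' : (mk t) ^ e ∈ P.map mk := ⟨t ^ e, hte, by simp [mk]⟩
    have ht_conj' : ∀ w : G ⧸ N, ∃ a : ℕ, ∃ y ∈ P.map mk, w * mk t * w⁻¹ = (mk t) ^ a * y := by
      intro w
      obtain ⟨w, rfl⟩ := hsurj w
      obtain ⟨a, y, hy, h⟩ := ht_conj w
      exact ⟨a, mk y, Subgroup.mem_map_of_mem _ hy, by simpa [mk] using congrArg mk h⟩
    have hs_conj' : ∀ w : G ⧸ N, ∃ a : ℕ, ∃ y ∈ P.map mk,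
        w * mk s * w⁻¹ = (mk t) ^ a * mk s * y := by
      intro w
      obtain ⟨w, rfl⟩ := hsurj w
      obtain ⟨a, y, hy, h⟩ := hs_conj w
      exact ⟨a, mk y, Subgroup.mem_map_of_mem _ hy, by simpa [mk] using congrArg mk h⟩
    have hgen' : Subgroup.closure (Set.range (fun j => mk (g j))) = ⊤ := by
      rw [Set.range_comp' , ← MonoidHom.map_closure, hgen, Subgroup.map_top_of_surjective _ hsurj]
    have hslots' : ∀ j, mk (g j) ∈ P.map mk ∨ mk (g j) = mk t ∨ mk (g j) = mk s := by
      intro j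
      rcases hslots j with h | h | h
      · exact Or.inl (Subgroup.mem_map_of_mem _ h)
      · exact Or.inr (Or.inl (by rw [h]))
      · exact Or.inr (Or.inr (by rw [h]))
    have hPgen' : P.map mk ≤ Subgroup.normalClosure
        {x | x ∈ Set.range (fun j => mk (g j)) ∧ x ∈ P.map mk} := by
      refine (Subgroup.map_mono hPgen).trans ((Subgroup.map_normalClosure_le _ _).trans
        (Subgroup.normalClosure_mono ?_))
      rintro _ ⟨x, ⟨⟨j, rfl⟩, hx⟩, rfl⟩
      exact ⟨⟨j, rfl⟩, Subgroup.mem_map_of_mem _ hx⟩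
    have hKP' : K.map mk ≤ P.map mk := Subgroup.map_mono hKP
    have hKG' : ⁅K.map mk, (⊤ : Subgroup (G ⧸ N))⁆ = K.map mk := by
      rw [← Subgroup.map_top_of_surjective mk hsurj, ← Subgroup.map_commutator, hKG]
    have hKHn' : K.map mk ≤ Hn.map mk := Subgroup.map_mono hKHn
    -- the approximate solution in `G ⧸ N`
    have hκ' : (mk κ)⁻¹ * (List.ofFn fun j =>
        ⁅mk (x j), mk (c j) * mk (g j) * (mk (c j))⁻¹⁆).prod ∈ K.map mk := by
      rw [← map_prod_commutator_conj mk g c x, ← map_inv, ← map_mul]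
      exact Subgroup.mem_map_of_mem _ hκ
    obtain ⟨xbar, hxbar, hsol⟩ := ih (P.map mk) hPp' (mk t) (mk s) e hte' hpe ht_conj' hs_conj'
      (fun j => mk (g j)) hgen' hslots' jt js (by rw [hjt]) (by rw [hjs]) hPgen' (K.map mk) hKP'
      hKG' hcardK' (Hn.map mk) hKHn' (fun j => mk (c j)) (mk κ) (fun j => mk (x j))
      (fun j => Subgroup.mem_map_of_mem _ (hx j)) hκ'
    -- lift the entries back to `Hn`
    have hlift : ∀ j, ∃ y : G, y ∈ Hn ∧ mk y = xbar j := fun j => Subgroup.mem_map.mp (hxbar j)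
    choose x₁ hx₁Hn hx₁ using hlift
    have hκ₁ : κ⁻¹ * (List.ofFn fun j => ⁅x₁ j, c j * g j * (c j)⁻¹⁆).prod ∈ N := by
      rw [← QuotientGroup.eq_one_iff, ← QuotientGroup.mk'_apply, map_mul, map_inv,
        map_prod_commutator_conj mk g c x₁]
      simp only [hx₁]
      exact hsol
    -- exact lifting through `N`
    exact lift_through_qmn P hPp t s hte hpe ht_conj hs_conj g hgen hslots jt js hjt hjs hPgen N hNP
      hNG hN1 hmin Hn hNHn c κ x₁ hx₁Hn hκ₁

/-! ### The main theorem -/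

/-- **Bounded commutator width (N–S-free) for `p`-group-by-metacyclic finite groups.**  In the setting of
the module docstring (`P ⊴ G` a normal `p`-subgroup; `t, s` with `(T1)–(T3)`; slots `g` with
`(G1)–(G4)`), for every normal subgroup `H ≤ P` every element of `⁅H, G⁆` is an ordered product
`∏_{j<d} ⁅y_j, g_j⁆` with all `y_j ∈ H`:  `⁅H, G⁆ = ⁅H, g_0⁆ ⋯ ⁅H, g_{d-1}⁆` as a product of sets.
Elementary (no classification of finite simple groups); for the class of groups at hand this is the
conclusion of Nikolov–Segal, Ann. of Math. 165 (2007), Thm 1.2 / Key Theorem with an explicit bound.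
[cite: NikolovSegal2007, Theorem 1.2] -/
theorem commutator_eq_prod_commutator_slots {G : Type u} [Group G] [Finite G] {p : ℕ} [Fact p.Prime]
    (P : Subgroup G) [P.Normal] (hPp : IsPGroup p P) (t s : G) {e : ℕ} (hte : t ^ e ∈ P)
    (hpe : p.Coprime e)
    (ht_conj : ∀ w : G, ∃ a : ℕ, ∃ y ∈ P, w * t * w⁻¹ = t ^ a * y)
    (hs_conj : ∀ w : G, ∃ a : ℕ, ∃ y ∈ P, w * s * w⁻¹ = t ^ a * s * y)
    {d : ℕ} (g : Fin d → G) (hgen : Subgroup.closure (Set.range g) = ⊤)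
    (hslots : ∀ j, g j ∈ P ∨ g j = t ∨ g j = s) (jt js : Fin d) (hjt : g jt = t) (hjs : g js = s)
    (hPgen : P ≤ Subgroup.normalClosure {x | x ∈ Set.range g ∧ x ∈ P})
    (H : Subgroup G) [hH : H.Normal] (hHP : H ≤ P) {h : G} (hh : h ∈ ⁅H, (⊤ : Subgroup G)⁆) :
    ∃ v : Fin d → G, (∀ j, v j ∈ H) ∧ h = (List.ofFn fun j => ⁅v j, g j⁆).prod := by
  -- the hypocentral residual `K₀ = ⁅H,_m G⁆ = ⁅K₀, G⁆`
  obtain ⟨m, hm⟩ := exists_iterate_commutator_top_eq_succ H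
  set K₀ : Subgroup G := (fun K : Subgroup G => ⁅K, (⊤ : Subgroup G)⁆)^[m] H with hK₀
  haveI : K₀.Normal := normal_iterate_commutator_top H m
  have hK₀H : K₀ ≤ H := iterate_commutator_top_le H m
  -- top stage (N–S Lemma 2.4): `Φ(v)⁻¹ h ∈ ⁅H,_{m+1} G⁆ = K₀`
  obtain ⟨v, hvH, hv⟩ := exists_prod_commutator_inv_mul_mem_iterate g hgen H m hh
  rw [Function.iterate_succ_apply', hm] at hv
  -- exact lifting through `K₀`
  have hκ : h⁻¹ * (List.ofFn fun j => ⁅v j, (1 : G) * g j * (1 : G)⁻¹⁆).prod ∈ K₀ := by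
    have : h⁻¹ * (List.ofFn fun j => ⁅v j, (1 : G) * g j * (1 : G)⁻¹⁆).prod =
        (((List.ofFn fun j => ⁅v j, g j⁆).prod)⁻¹ * h)⁻¹ := by simp
    rw [this]; exact K₀.inv_mem hv
  obtain ⟨x, hxH, hx⟩ := lift_of_commutator_eq_self (Nat.card K₀) P hPp t s e hte hpe ht_conj hs_conj
    g hgen hslots jt js hjt hjs hPgen K₀ (hK₀H.trans hHP) hm le_rfl H hK₀H (fun _ => 1) h v hvH hκ
  refine ⟨x, hxH, ?_⟩
  have hx' : h⁻¹ * (List.ofFn fun j => ⁅x j, g j⁆).prod = 1 := by simpa using hx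
  rw [inv_mul_eq_one] at hx'
  exact hx'

/-- **Bounded width with `n`-th powers.**  In the same setting, every element of the subgroup
`⁅H, G⁆ ⊔ ⟨xⁿ : x ∈ H⟩` (abstractly generated) is of the form `yⁿ · ∏_{j<d} ⁅y_j, g_j⁆` with
`y, y_j ∈ H` (modulo `⁅H,G⁆ ⊇ ⁅H,H⁆` the `n`-th powers of the abelian group `H/⁅H,G⁆` form a subgroup).
[cite: NikolovSegal2007, Theorem 1.2] -/
theorem exists_pow_mul_prod_commutator_of_mem_sup {G : Type u} [Group G] [Finite G] {p : ℕ}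
    [Fact p.Prime] (P : Subgroup G) [P.Normal] (hPp : IsPGroup p P) (t s : G) {e : ℕ}
    (hte : t ^ e ∈ P) (hpe : p.Coprime e)
    (ht_conj : ∀ w : G, ∃ a : ℕ, ∃ y ∈ P, w * t * w⁻¹ = t ^ a * y)
    (hs_conj : ∀ w : G, ∃ a : ℕ, ∃ y ∈ P, w * s * w⁻¹ = t ^ a * s * y)
    {d : ℕ} (g : Fin d → G) (hgen : Subgroup.closure (Set.range g) = ⊤)
    (hslots : ∀ j, g j ∈ P ∨ g j = t ∨ g j = s) (jt js : Fin d) (hjt : g jt = t) (hjs : g js = s)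
    (hPgen : P ≤ Subgroup.normalClosure {x | x ∈ Set.range g ∧ x ∈ P})
    (H : Subgroup G) [hH : H.Normal] (hHP : H ≤ P) (n : ℕ) {a : G}
    (ha : a ∈ ⁅H, (⊤ : Subgroup G)⁆ ⊔ Subgroup.closure {y | ∃ x ∈ H, x ^ n = y}) :
    ∃ y ∈ H, ∃ v : Fin d → G, (∀ j, v j ∈ H) ∧
      a = y ^ n * (List.ofFn fun j => ⁅v j, g j⁆).prod := by
  classical
  set C : Subgroup G := ⁅H, (⊤ : Subgroup G)⁆ with hC
  let mk := QuotientGroup.mk' C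
  -- images of `H` commute modulo `C ⊇ ⁅H, H⁆`
  have hcomm : ∀ x ∈ H, ∀ y ∈ H, Commute (mk x) (mk y) := by
    intro x hx y hy
    rw [Commute, SemiconjBy, ← map_mul, ← map_mul, QuotientGroup.mk'_apply, QuotientGroup.mk'_apply,
      QuotientGroup.eq]
    have : (x * y)⁻¹ * (y * x) = ⁅y⁻¹, x⁻¹⁆ := by simp only [commutatorElement_def]; group
    rw [this]
    exact Subgroup.commutator_mem_commutator (H.inv_mem hy) (Subgroup.mem_top _)
  -- every element of `closure {xⁿ}` is `yⁿ` modulo `C`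
  have hpow : ∀ b ∈ Subgroup.closure {y | ∃ x ∈ H, x ^ n = y}, ∃ y ∈ H, mk b = mk (y ^ n) := by
    intro b hb
    induction hb using Subgroup.closure_induction with
    | mem x hx =>
      obtain ⟨y, hy, rfl⟩ := hx
      exact ⟨y, hy, rfl⟩
    | one => exact ⟨1, H.one_mem, by simp⟩
    | mul x y _ _ hx hy =>
      obtain ⟨a₁, ha₁, h₁⟩ := hx
      obtain ⟨a₂, ha₂, h₂⟩ := hy
      refine ⟨a₁ * a₂, H.mul_mem ha₁ ha₂, ?_⟩
      rw [map_mul, h₁, h₂, map_pow, map_pow, map_pow, map_mul, (hcomm a₁ ha₁ a₂ ha₂).mul_pow]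
    | inv x _ hx =>
      obtain ⟨a₁, ha₁, h₁⟩ := hx
      refine ⟨a₁⁻¹, H.inv_mem ha₁, ?_⟩
      rw [map_inv, h₁, map_pow, map_pow, map_inv, inv_pow]
  -- decompose `a = b * w` with `b ∈ closure {xⁿ}`, `w ∈ C`
  have ha' : a ∈ ((Subgroup.closure {y | ∃ x ∈ H, x ^ n = y} ⊔ C : Subgroup G) : Set G) := by
    rw [sup_comm]; exact ha
  rw [Subgroup.mul_normal] at ha'
  obtain ⟨b, hb, w, hw, rfl⟩ := Set.mem_mul.mp ha'
  obtain ⟨y, hy, hby⟩ := hpow b hb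
  -- `b = yⁿ * w'` with `w' ∈ C`
  have hw' : (y ^ n)⁻¹ * b ∈ C := by
    rw [← QuotientGroup.eq, ← QuotientGroup.mk'_apply, ← QuotientGroup.mk'_apply]; exact hby.symm
  have hmem : (y ^ n)⁻¹ * b * w ∈ C := C.mul_mem hw' hw
  obtain ⟨v, hvH, hv⟩ := commutator_eq_prod_commutator_slots P hPp t s hte hpe ht_conj hs_conj g
    hgen hslots jt js hjt hjs hPgen H hHP hmem
  refine ⟨y, hy, v, hvH, ?_⟩
  rw [← hv]; group

end Literature.GroupTheory
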